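import Summits.QuantumFields.YangMills.Theorems.RenyiTelescopeHistoryTailOfRenyiTelescope
import Summits.QuantumFields.YangMills.Theorems.SmallFieldWideningLargeFieldMassRefinementTailOfSummableUnitTop
import Literature.MathematicalPhysics.QuantumFieldTheory.Balaban1983to89.T3AveragedTailProfile

/-!
# Route `SmallFieldWidening`, crux r3 `LargeFieldMassRefinementTail` (stmt-QuantumFields-22884), line `birth` v7 — THE REGISTERED STUB
# `stub_unitTopSummable` (hence r3 BY NAME) FROM THE TWO CRUXES OF ROUTE `RenyiTelescope` (`CutoffRenyiL`, stmt-QuantumFields-27137, and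
# `FineRegimeUnitTailL`, stmt-QuantumFields-27138)
# (support file; width seat `ym-line-sfw-p2-w2` gen 18; the stub, both cruxes, r3 and rung R3 stay OPEN)

WHAT THIS IS NOT.  No Gibbs-measure estimate of Bałaban's programme is proved here; the two cruxes of LINE «RenyiTelescope» (ideator seat
`ym-r3-idea-2` g3) are HYPOTHESES; nothing bears on the Yang–Mills mass gap; rung R3 (`YM3TorusSU2`) is a RECORD rung and is NOT proved.

THE POINT.  The landed glue of route `RenyiTelescope` (`historyTailOfRenyiTelescope`, p625731: `CutoffRenyiL → FineRegimeUnitTailL → HistoryTailL`)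
passes through an internal UNIT-EVENT TAIL SCHEMA (the conclusion of `RenyiTelescope.stub_glueRest`): for every block size `L` an interior ratio
`c ∈ (0,1]` and thresholds, for every profile `(b₀, p₀)` above them a `γ₁ ∈ (0,1]`, and for every family `F` (`F.L = L`) at every `0 < γ ≤ γ₁`
constants `h₀, C, a` (depending on `F, γ`) with, for EVERY depth `d ≥ h₀`, EVERY cut-off `J ≥ 1` (uniformly) and every unit plaquette `p` of `F.refine d`,
  `Gibbs^{F.refine d}_{J, γL^{-d}}( (unitA)⁻¹{θ_{c b₀}(0) ≤ |V(∂p) − 1|} ∩ histGoodInt (F.refine d) θ_{b₀} (θ_{c b₀} 1) J 1 ) ≤ C·exp(−a·p_{b₀}(√(γL^{-d}))²)`.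
The unit-top first-exit event of the registered stub `stub_unitTopSummable` of crux r3's skeleton v7, taken at the profile `(c·b₀, p₀)` —
«every sub-unit block field `Ū^k` (`k < K`) is `θ_{c b₀}(K−k)`-small ∧ `θ_{c b₀}(0) ≤ |Ū^K(∂p) − 1|`» — is a SUB-EVENT of that event on the SAME
refined family (§1, `unitTop_subset_unitEvent`: `unitA = fieldShift ∘ Ū^K` and `plaqHol_fieldShift` identify the bad unit plaquette; a
`θ_{c b₀}`-small history is `θ_{b₀}`-small (`θBal_scaled_le`, `c ≤ 1`) and its height `1` is the interior `c`-window, `histGood_subset_histGoodInt`) —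
no level shift and no plaquette transport are needed.  Hence (§2, ★ `unitTopSummable_of_unitEventSchema`) the schema gives the registered stub's
signature VERBATIM with the profile `q d = 𝟙[d < h₀] + C·e^{−a p_{b₀}(g_d)²}`, summable against `(L^d)³` by the tree's per-height arithmetic
(`T3AveragedTailProfile.perHeight_bound`), and (§3) BY NAME:
* ★ `unitTopSummable_of_renyiTelescope : CutoffRenyiL → FineRegimeUnitTailL → ‹stub_unitTopSummable›`;
* ★ `largeFieldMassRefinementTail_of_renyiTelescope : CutoffRenyiL → FineRegimeUnitTailL → LargeFieldMassRefinementTail` (through the lead's landed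
  glue `largeFieldMassRefinementTail_of_unitTopSummable`, p621457);
* `historyTailL_and_largeFieldMassRefinementTail_of_renyiTelescope` — the STAFFING FACT: closing the two cruxes 27137 + 27138 closes crux K2-L
  `HistoryTailL` (19936, their own glue) AND crux r3 (22884) simultaneously.
So route RenyiTelescope joins the census of sufficient feeders of r3 (26243 `FirstExitWindowTailL`, 2′χ, `IntCoreRec`, one χ-record, 25301,
25567 ∧ 25568, per-family density ratios, `CondStabFam`, `LocalUnitStabilityL`); like all of them it is open and its producers are conditional.

References: T. Bałaban, Commun. Math. Phys. **102** (1985) 255–275 [Balaban1985UV3] ((1)–(3) p.256, (7) p.257, (70)–(71) p.273); CMP **109** (1987)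
249–301 [Balaban1987RG1] ((0.4)/(0.11) p.253); C. King, CMP **103** (1986) 323–349 [King1986] (Thm 3.4 p.334, the lattice-artefact exponent behind
`CutoffRenyiL`).
-/

noncomputable section

open MeasureTheory Filter Topology
open Literature.MathematicalPhysics.QuantumFieldTheory.Balaban1983to89
open Literature.MathematicalPhysics.QuantumFieldTheory.Balaban1983to89.Missing
open Literature.MathematicalPhysics.QuantumFieldTheory.Balaban1983to89.T3ContinuumYM3Torus
open Literature.MathematicalPhysics.QuantumFieldTheory.Balaban1983to89.T3UnitScaleTilt
open Literature.MathematicalPhysics.QuantumFieldTheory.Balaban1983to89.T3UnitLawDensityEML (ℰp measurableE_ℰp)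
open Literature.MathematicalPhysics.QuantumFieldTheory.Balaban1983to89.T3LevelShift
open Literature.MathematicalPhysics.QuantumFieldTheory.Balaban1983to89.T3InteriorExcision
open Literature.MathematicalPhysics.QuantumFieldTheory.Balaban1983to89.T3AveragedTailProfile (perHeight_bound)
open Summit.QuantumFields.YangMills.Theorems.RenyiTelescope (θBal_scaled_le)
open Summit.QuantumFields.YangMills.Theorems.LargeFieldMassRefinementTailOfSummableUnitTop (largeFieldMassRefinementTail_of_unitTopSummable)

namespace Summit.QuantumFields.YangMills.Theorems.LargeFieldMassRefinementTailOfRenyiTelescope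

/-! ## §1 The unit-top first-exit event is a sub-event of the interior-conditioned unit event of route `RenyiTelescope` (same family, same run) -/

section Inclusion

/-- **THE EVENT INCLUSION.**  For a family `G`, two threshold profiles `θ' ≤ θ`, a run `K ≥ 1` and a unit plaquette `p` of the `K`-averaged lattice: the event
«`Ū^k` is `θ'(K−k)`-small for every `k < K` ∧ `θ'(0) ≤ |Ū^K(∂p) − 1|`» lies in `(unitA G K)⁻¹{θ'(0) ≤ |W(∂p̂) − 1|} ∩ histGoodInt G θ (θ' 1) K 1`, where `p̂` is `p`
read on the unit-lattice labels (`unitA = fieldShift ∘ Ū^K`, `plaqHol_fieldShift`; a `θ'`-small history is `θ`-small and its height `1` is the `θ'(1)`-window).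
[cite: Balaban1987RG1, (0.4)/(0.11) p.253] -/
theorem unitTop_subset_unitEvent (G : T3Family) {θ θ' : ℕ → ℝ} (h : ∀ i, θ' i ≤ θ i) {K : ℕ} (hK : 1 ≤ K) (p : Plaq (G.P K) K) :
    {V : GaugeField (G.P K) 0 (Matrix.specialUnitaryGroup (Fin 2) ℂ) |
        (∀ k, k < K → PlaqSmall (θ' (K - k)) (Averaging.iter (fun i => BlockAveraging.blockAvg (P := G.P K) (j := i) ℰp) k V)) ∧
          θ' 0 ≤ GaugeGroup.dist1 (GaugeField.plaqHol
            (Averaging.iter (fun i => BlockAveraging.blockAvg (P := G.P K) (j := i) ℰp) K V) p)} ⊆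
      (unitA G ℰp K) ⁻¹' {W | θ' 0 ≤ GaugeGroup.dist1 (GaugeField.plaqHol W ((plaqShift (G.sitesPerDir_unit K)).symm p))} ∩
        histGoodInt G θ (θ' 1) K 1 := by
  intro V hV
  obtain ⟨hhist, htop⟩ := hV
  refine ⟨?_, ?_⟩
  · show θ' 0 ≤ GaugeGroup.dist1 (GaugeField.plaqHol (unitA G ℰp K V) ((plaqShift (G.sitesPerDir_unit K)).symm p))
    unfold unitA
    erw [unitShift_eq, plaqHol_fieldShift, Equiv.apply_symm_apply]
    exact htop
  · refine histGood_subset_histGoodInt G h hK le_rfl ?_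
    intro j hj
    exact hhist j (by omega)

end Inclusion

/-! ## §2 The registered stub's signature from the unit-event tail schema of route `RenyiTelescope` -/

section Schema

/-- ★ **`stub_unitTopSummable` ⇐ THE UNIT-EVENT TAIL SCHEMA OF ROUTE `RenyiTelescope`** (the conclusion of `RenyiTelescope.stub_glueRest`): at the profile
`(c·b₀, p₀)` (`b₀ = max b₁ 1`, `p₀ = max p₁ 3`) and the schema's `γ₁`, every family at every `0 < γ ≤ γ₁` gets the profile `q d = 𝟙[d < h₀] + C·e^{−a p_{b₀}(g_d)²}`
— summable against `(L^d)³` by `perHeight_bound` — bounding its unit-top first-exit masses uniformly in the run length, by §1 and monotonicity of measure.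
Conditional certificate (the schema is a hypothesis); nothing about the mass gap. [cite: Balaban1985UV3, (7) p.257 and (70)-(71) p.273] -/
theorem unitTopSummable_of_unitEventSchema
    (hS : ∀ (L : ℕ), ∃ (c b₁ p₁ : ℝ), 0 < c ∧ c ≤ 1 ∧ ∀ (b₀ p₀ : ℝ), b₁ ≤ b₀ → p₁ ≤ p₀ → 0 < b₀ → 2 < p₀ →
      ∃ γ₁ : ℝ, 0 < γ₁ ∧ γ₁ ≤ 1 ∧ ∀ (F : T3Family) (γ : ℝ), F.L = L → 0 < γ → γ ≤ γ₁ →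
        ∃ (h₀ : ℕ) (C a : ℝ), 0 ≤ C ∧ 0 < a ∧ ∀ (d J : ℕ) (p : Plaq ((F.refine d).P 0) 0), h₀ ≤ d → 1 ≤ J →
          (gibbsK (F.refine d) ℰp (γ * ((F.L : ℝ)⁻¹) ^ d) J).real
              ((unitA (F.refine d) ℰp J) ⁻¹'
                  {V | θBal F.L (γ * ((F.L : ℝ)⁻¹) ^ d) (c * b₀) p₀ 0 ≤ GaugeGroup.dist1 (GaugeField.plaqHol V p)} ∩
                histGoodInt (F.refine d) (θBal F.L (γ * ((F.L : ℝ)⁻¹) ^ d) b₀ p₀)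
                  (θBal F.L (γ * ((F.L : ℝ)⁻¹) ^ d) (c * b₀) p₀ 1) J 1) ≤
            C * Real.exp (-(a * (B10.pFun b₀ p₀ (Real.sqrt (γ * ((F.L : ℝ)⁻¹) ^ d))) ^ 2))) :
    ∀ L : ℕ, ∃ (b₀ p₀ γ₁ : ℝ), 0 < b₀ ∧ 2 < p₀ ∧ 0 < γ₁ ∧ γ₁ ≤ 1 ∧ ∀ (F : T3Family) (γ : ℝ), F.L = L → 0 < γ → γ ≤ γ₁ →
      ∃ q : ℕ → ℝ, (∀ d, 0 ≤ q d) ∧ Summable (fun d : ℕ => ((F.L : ℝ) ^ d) ^ 3 * q d) ∧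
        ∀ (d K : ℕ), 2 ≤ K → ∀ p : Plaq ((F.refine d).P K) K,
          (T3UnitScaleTilt.gibbsK (F.refine d) T3UnitLawDensityEML.ℰp (γ * ((F.L : ℝ)⁻¹) ^ d) K).real
              {V | (∀ k, k < K → PlaqSmall (T3UnitScaleTilt.θBal F.L (γ * ((F.L : ℝ)⁻¹) ^ d) b₀ p₀ (K - k))
                  (Averaging.iter (fun i => BlockAveraging.blockAvg (P := (F.refine d).P K) (j := i) T3UnitLawDensityEML.ℰp) k V)) ∧
                T3UnitScaleTilt.θBal F.L (γ * ((F.L : ℝ)⁻¹) ^ d) b₀ p₀ 0 ≤ GaugeGroup.dist1 (GaugeField.plaqHol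
                  (Averaging.iter (fun i => BlockAveraging.blockAvg (P := (F.refine d).P K) (j := i) T3UnitLawDensityEML.ℰp) K V) p)} ≤
            q d := by
  classical
  intro L
  obtain ⟨c, b₁, p₁, hc, hc1, hS1⟩ := hS L
  -- the profile `b₀ = max b₁ 1`, `p₀ = max p₁ 3`
  set b₀ : ℝ := max b₁ 1 with hb₀def
  set p₀ : ℝ := max p₁ 3 with hp₀def
  have hb₀ : 0 < b₀ := lt_of_lt_of_le one_pos (le_max_right _ _)
  have hp₀ : 2 < p₀ := lt_of_lt_of_le (by norm_num) (le_max_right _ _)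
  have hp₀1 : 1 ≤ p₀ := by linarith
  obtain ⟨γ₁, hγ₁, hγ₁1, hS2⟩ := hS1 b₀ p₀ (le_max_left _ _) (le_max_left _ _) hb₀ hp₀
  refine ⟨c * b₀, p₀, γ₁, mul_pos hc hb₀, hp₀, hγ₁, hγ₁1, fun F γ hFL hγ hγle => ?_⟩
  have hγ1 : γ ≤ 1 := hγle.trans hγ₁1
  obtain ⟨h₀, C, a, hC, ha, hbound⟩ := hS2 F γ hFL hγ hγle
  have hL1 : (1 : ℝ) ≤ F.L := by exact_mod_cast F.hL.2.le
  have hL0 : (0 : ℝ) < F.L := one_pos.trans_le hL1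
  have hLi0 : (0 : ℝ) ≤ ((F.L : ℝ)⁻¹) := inv_nonneg.mpr hL0.le
  have hLi1 : ((F.L : ℝ)⁻¹) ≤ 1 := inv_le_one_of_one_le₀ hL1
  -- the Gaussian part of the profile and its per-height arithmetic (exponent `A = 0`)
  set g : ℕ → ℝ := fun d => C * Real.exp (-(a * (B10.pFun b₀ p₀ (Real.sqrt (γ * ((F.L : ℝ)⁻¹) ^ d))) ^ 2)) with hgdef
  have hg0 : ∀ d, 0 ≤ g d := fun d => mul_nonneg hC (Real.exp_nonneg _)
  set A' : ℝ := 72 * C * (F.L : ℝ) ^ (3 * F.m) * γ⁻¹ ^ (0 : ℕ) *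
    Real.exp ((((3 : ℝ) + (0 : ℕ)) * Real.log F.L + Real.log 2) ^ 2 / (4 * (a * b₀ ^ 2 * Real.log F.L ^ 2 / 4))) with hA'def
  have hPH : ∀ d : ℕ, ((F.L : ℝ) ^ d) ^ 3 * g d ≤ A' * ((1 : ℝ) / 2) ^ d := by
    intro d
    have hvol1 : (1 : ℝ) ≤ 9 * (8 * (F.L : ℝ) ^ (3 * F.m)) := by
      have : (1 : ℝ) ≤ (F.L : ℝ) ^ (3 * F.m) := one_le_pow₀ hL1
      nlinarith
    have hph := perHeight_bound F hγ hγ1 hb₀ hp₀1 hC 0 ha d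
    rw [pow_zero, mul_one] at hph
    calc ((F.L : ℝ) ^ d) ^ 3 * g d ≤ (9 * (8 * (F.L : ℝ) ^ (3 * F.m))) * (((F.L : ℝ) ^ d) ^ 3 * g d) :=
          le_mul_of_one_le_left (mul_nonneg (pow_nonneg (pow_nonneg hL0.le d) 3) (hg0 d)) hvol1
      _ = (9 * (8 * (F.L : ℝ) ^ (3 * F.m) * ((F.L : ℝ) ^ d) ^ 3)) * g d := by ring
      _ ≤ A' * ((1 : ℝ) / 2) ^ d := hph
  have hA'0 : 0 ≤ A' := by
    have h0 := hPH 0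
    simp only [pow_zero, one_pow, mul_one, one_mul] at h0
    exact (hg0 0).trans h0
  refine ⟨fun d => (if d < h₀ then (1 : ℝ) else 0) + g d, fun d => add_nonneg (by split_ifs <;> norm_num) (hg0 d), ?_,
    fun d K hK p => ?_⟩
  · -- summability against `(L^d)³`: a finitely supported part plus the per-height bound `≤ A'·2^{-d}`
    have hfin : Summable (fun d : ℕ => ((F.L : ℝ) ^ d) ^ 3 * (if d < h₀ then (1 : ℝ) else 0)) := by
      refine summable_of_hasFiniteSupport ((Finset.range h₀).finite_toSet.subset ?_)
      intro d hd
      simp only [Function.mem_support, ne_eq, mul_eq_zero, not_or] at hd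
      simp only [Finset.coe_range, Set.mem_Iio]
      by_contra hlt
      exact hd.2 (if_neg hlt)
    have hgs : Summable (fun d : ℕ => ((F.L : ℝ) ^ d) ^ 3 * g d) :=
      Summable.of_nonneg_of_le (fun d => mul_nonneg (pow_nonneg (pow_nonneg hL0.le d) 3) (hg0 d)) hPH
        ((summable_geometric_of_lt_one (by norm_num) (by norm_num)).mul_left A')
    refine (hfin.add hgs).congr fun d => ?_
    ring
  · -- the bound: trivial below the depth threshold, §1 + the schema above it
    have hγd0 : 0 ≤ γ * ((F.L : ℝ)⁻¹) ^ d := mul_nonneg hγ.le (pow_nonneg hLi0 d)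
    haveI := isProbabilityMeasure_gibbsK (F.refine d) ℰp hγd0 K
    show _ ≤ (if d < h₀ then (1 : ℝ) else 0) + g d
    by_cases hd : d < h₀
    · rw [if_pos hd]
      exact measureReal_le_one.trans (le_add_of_nonneg_right (hg0 d))
    · rw [if_neg hd, zero_add]
      have hγd : 0 < γ * ((F.L : ℝ)⁻¹) ^ d := mul_pos hγ (pow_pos (inv_pos.mpr hL0) d)
      have hγd1 : γ * ((F.L : ℝ)⁻¹) ^ d ≤ 1 :=
        (mul_le_of_le_one_right hγ.le (pow_le_one₀ hLi0 hLi1)).trans hγ1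
      have hK1 : 1 ≤ K := by omega
      -- §1 on the refined family with `θ' = θ_{c b₀} ≤ θ = θ_{b₀}`
      have hsub := unitTop_subset_unitEvent (F.refine d)
        (θ := θBal F.L (γ * ((F.L : ℝ)⁻¹) ^ d) b₀ p₀) (θ' := θBal F.L (γ * ((F.L : ℝ)⁻¹) ^ d) (c * b₀) p₀)
        (fun i => θBal_scaled_le F.hL.2.le hγd hγd1 hb₀ hc1 p₀ i) hK1 p
      refine (measureReal_mono hsub).trans ?_
      exact hbound d K ((plaqShift ((F.refine d).sitesPerDir_unit K)).symm p) (not_lt.mp hd) hK1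

end Schema

/-! ## §3 By name: the registered stub, crux r3 and the staffing fact from the two cruxes of route `RenyiTelescope` -/

section ByName

/-- ★ **THE REGISTERED STUB `stub_unitTopSummable` OF CRUX r3's SKELETON v7 ⇐ `CutoffRenyiL ∧ FineRegimeUnitTailL`** (cruxes stmt-QuantumFields-27137 /
27138 of route `RenyiTelescope`): their landed glue pieces (telescoped crux, conditional telescope, abstract bootstrap, interior complement, arithmetic
closure, instantiation `stub_glueRest`) produce the unit-event tail schema, and §2 applies.  Conditional certificate: both cruxes are OPEN; nothing about the
mass gap. [cite: Balaban1985UV3, (7) p.257 and (70)-(71) p.273; King1986, Thm 3.4 p.334] -/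
theorem unitTopSummable_of_renyiTelescope
    (hC : Summit.QuantumFields.YangMills.Theses.RenyiTelescope.CutoffRenyiL)
    (hF : Summit.QuantumFields.YangMills.Theses.RenyiTelescope.FineRegimeUnitTailL) :
    ∀ L : ℕ, ∃ (b₀ p₀ γ₁ : ℝ), 0 < b₀ ∧ 2 < p₀ ∧ 0 < γ₁ ∧ γ₁ ≤ 1 ∧ ∀ (F : T3Family) (γ : ℝ), F.L = L → 0 < γ → γ ≤ γ₁ →
      ∃ q : ℕ → ℝ, (∀ d, 0 ≤ q d) ∧ Summable (fun d : ℕ => ((F.L : ℝ) ^ d) ^ 3 * q d) ∧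
        ∀ (d K : ℕ), 2 ≤ K → ∀ p : Plaq ((F.refine d).P K) K,
          (T3UnitScaleTilt.gibbsK (F.refine d) T3UnitLawDensityEML.ℰp (γ * ((F.L : ℝ)⁻¹) ^ d) K).real
              {V | (∀ k, k < K → PlaqSmall (T3UnitScaleTilt.θBal F.L (γ * ((F.L : ℝ)⁻¹) ^ d) b₀ p₀ (K - k))
                  (Averaging.iter (fun i => BlockAveraging.blockAvg (P := (F.refine d).P K) (j := i) T3UnitLawDensityEML.ℰp) k V)) ∧
                T3UnitScaleTilt.θBal F.L (γ * ((F.L : ℝ)⁻¹) ^ d) b₀ p₀ 0 ≤ GaugeGroup.dist1 (GaugeField.plaqHol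
                  (Averaging.iter (fun i => BlockAveraging.blockAvg (P := (F.refine d).P K) (j := i) T3UnitLawDensityEML.ℰp) K V) p)} ≤
            q d :=
  unitTopSummable_of_unitEventSchema
    (RenyiTelescope.stub_glueRest (RenyiTelescope.stub_telescopedCrux hC RenyiTelescope.stub_conditionalTelescope) hF
      RenyiTelescope.stub_abstractBootstrap RenyiTelescope.stub_interiorComplement RenyiTelescope.stub_arithClosure)

/-- ★ **CRUX r3 `LargeFieldMassRefinementTail` (stmt-QuantumFields-22884) ⇐ `CutoffRenyiL ∧ FineRegimeUnitTailL`**, BY NAME, through the lead's landed glue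
`largeFieldMassRefinementTail_of_unitTopSummable` (skeleton v7).  Conditional certificate: both cruxes of route `RenyiTelescope` are OPEN; rung R3 and the mass
gap are NOT proved. [cite: Balaban1985UV3, (7) p.257 and (70)-(71) p.273; King1986, Thm 3.4 p.334] -/
theorem largeFieldMassRefinementTail_of_renyiTelescope
    (hC : Summit.QuantumFields.YangMills.Theses.RenyiTelescope.CutoffRenyiL)
    (hF : Summit.QuantumFields.YangMills.Theses.RenyiTelescope.FineRegimeUnitTailL) :
    Summit.QuantumFields.YangMills.Theses.SmallFieldWidening.LargeFieldMassRefinementTail :=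
  largeFieldMassRefinementTail_of_unitTopSummable (unitTopSummable_of_renyiTelescope hC hF)

/-- **THE STAFFING FACT**: the two cruxes of route `RenyiTelescope` close crux K2-L `HistoryTailL` of route `UnitScaleTilt` (stmt-QuantumFields-19936, their
own glue `historyTailOfRenyiTelescope`) AND crux r3 of route `SmallFieldWidening` (stmt-QuantumFields-22884) at once.  Conditional; nothing about the mass
gap. [cite: Balaban1985UV3, (7) p.257 and (70)-(71) p.273; King1986, Thm 3.4 p.334] -/
theorem historyTailL_and_largeFieldMassRefinementTail_of_renyiTelescope
    (hC : Summit.QuantumFields.YangMills.Theses.RenyiTelescope.CutoffRenyiL)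
    (hF : Summit.QuantumFields.YangMills.Theses.RenyiTelescope.FineRegimeUnitTailL) :
    Summit.QuantumFields.YangMills.Theses.UnitScaleTilt.HistoryTailL ∧
      Summit.QuantumFields.YangMills.Theses.SmallFieldWidening.LargeFieldMassRefinementTail :=
  ⟨historyTailOfRenyiTelescope hC hF, largeFieldMassRefinementTail_of_renyiTelescope hC hF⟩

end ByName

end Summit.QuantumFields.YangMills.Theorems.LargeFieldMassRefinementTailOfRenyiTelescope

end
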